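import Literature.NumberTheory.LFunctions.Zhang2022.Section3Lemma31
import HarnessLib

/-!
# Zhang (2022) §3 / §15: higher derivatives of `L(s,χ)` near `s = 1` for a primitive character

Topic `Literature/NumberTheory/LFunctions/Zhang2022` (Landau–Siegel audit tree; verdict-neutral).
Y. Zhang, *Discrete mean estimates and the Landau–Siegel zero*, arXiv:2211.02515v1 (2022)
[Zhang2022LandauSiegel] — **an unrefereed manuscript under adjudication; nothing here asserts or
denies its Theorems 1–2.** Companion of `Section3Lemma31.lean` (same namespace `Lemma31`): that file
proves, for `χ` primitive mod `q` with `log q ≥ 3`, the Pólya–Vinogradov-strength bound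
`‖L(w,χ)‖ ≤ 2e^{9/2}(1 + log q)` on `‖w − 1‖ ≤ 2/log q` (`norm_LFunction_le_near_one`) and, by
Cauchy's estimate on the circle of radius `1/log q`, `‖L′(w,χ)‖ ≤ 2e^{9/2}(1 + log q)·log q` on
`‖w − 1‖ ≤ 1/log q` (`norm_deriv_LFunction_le_near_one`). This file runs the SAME argument with the
iterated Cauchy estimate (Mathlib `Complex.norm_iteratedDeriv_le_of_forall_mem_sphere_norm_le`:
`‖f⁽ⁿ⁾(c)‖ ≤ n!·C/Rⁿ`):

* `norm_iteratedDeriv_LFunction_le_near_one` — **`‖L⁽ᵏ⁾(w,χ)‖ ≤ k!·2e^{9/2}(1 + log q)·(log q)ᵏ`**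
  for `‖w − 1‖ ≤ 1/log q`, every `k : ℕ`;
* `norm_iteratedDeriv_two_LFunction_one_le` — at `w = 1`, `k = 2`:
  `‖L″(1,χ)‖ ≤ 4e^{9/2}(1 + log q)(log q)²` (so `≪ log³q`), the input W3 of the §15 plan
  (LIB-QUEUE Q-31; consumer: the rate form of `Z22:§15.u056`).

Both are classical (`L⁽ᵏ⁾(1,χ) ≪_k log^{k+1} q`, e.g. by partial summation or, as here, by Cauchy's
inequality from the convexity/Pólya–Vinogradov bound near `1`); the constants are the tree's.

## References

* Y. Zhang, arXiv:2211.02515v1 (2022), §3 (proof of Lemma 3.1), §15 p. 87.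
  [cite: Zhang2022LandauSiegel, §3 Lemma 3.1 (proof); §15 p. 87]
* H. L. Montgomery, R. C. Vaughan, *Multiplicative Number Theory I*, CUP 2007, §11.1 (11.8)
  (`L⁽ᵏ⁾(1,χ) ≪ logᵏ⁺¹ q`). [cite: MontgomeryVaughan2007, §11.1]
-/

noncomputable section

open Complex Filter Topology Set Real Metric

namespace Literature.NumberTheory.LFunctions.Zhang2022.Lemma31

section NearOne

variable {q : ℕ} [NeZero q] (χ : DirichletCharacter ℂ q)

/-- **`L⁽ᵏ⁾(w, χ)` near `w = 1`**: for `χ` primitive mod `q`, `log q ≥ 3`, `‖w − 1‖ ≤ 1/log q` and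
every `k`, `‖L⁽ᵏ⁾(w,χ)‖ ≤ k!·2e^{9/2}(1 + log q)·(log q)ᵏ` (Cauchy's estimate for the `k`-th
derivative on the circle `‖z − w‖ = 1/log q`, on which `‖L(z,χ)‖ ≤ 2e^{9/2}(1 + log q)` by the tree's
`norm_LFunction_le_near_one`). [cite: MontgomeryVaughan2007, §11.1] -/
theorem norm_iteratedDeriv_LFunction_le_near_one (k : ℕ) (hq : 3 ≤ Real.log q)
    (hχ : χ.IsPrimitive) {w : ℂ} (hw : ‖w - 1‖ ≤ 1 / Real.log q) :
    ‖iteratedDeriv k χ.LFunction w‖ ≤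
      k.factorial * (2 * Real.exp (9 / 2) * (1 + Real.log q)) * Real.log q ^ k := by
  have hq2 : 2 ≤ q := by
    rcases Nat.lt_or_ge q 2 with h | h
    · interval_cases q <;> norm_num at hq
    · exact h
  set Lq : ℝ := Real.log q with hL
  have hL0 : 0 < Lq := by linarith
  have hχ1 := ne_one_of_isPrimitive χ hq2 hχ
  have hR : 0 < 1 / Lq := one_div_pos.2 hL0
  have hd : DiffContOnCl ℂ χ.LFunction (ball w (1 / Lq)) :=
    (DirichletCharacter.differentiable_LFunction hχ1).diffContOnCl
  have hM : ∀ z ∈ sphere w (1 / Lq), ‖χ.LFunction z‖ ≤ 2 * Real.exp (9 / 2) * (1 + Lq) := by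
    intro z hz
    refine norm_LFunction_le_near_one χ hq hχ ?_
    rw [mem_sphere, dist_eq_norm] at hz
    calc ‖z - 1‖ = ‖(z - w) + (w - 1)‖ := by ring_nf
      _ ≤ ‖z - w‖ + ‖w - 1‖ := norm_add_le _ _
      _ ≤ 1 / Lq + 1 / Lq := add_le_add hz.le hw
      _ = 2 / Real.log q := by rw [hL]; ring
  have h := Complex.norm_iteratedDeriv_le_of_forall_mem_sphere_norm_le k hR hd hM
  calc ‖iteratedDeriv k χ.LFunction w‖
      ≤ k.factorial * (2 * Real.exp (9 / 2) * (1 + Lq)) / (1 / Lq) ^ k := h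
    _ = k.factorial * (2 * Real.exp (9 / 2) * (1 + Lq)) * Lq ^ k := by
        rw [one_div, inv_pow, div_inv_eq_mul]

/-- **`‖L″(1, χ)‖ ≤ 4e^{9/2}(1 + log q)(log q)²`** for `χ` primitive mod `q`, `log q ≥ 3` (the case
`k = 2`, `w = 1` of `norm_iteratedDeriv_LFunction_le_near_one`; in particular `L″(1,χ) ≪ log³ q`).
[cite: MontgomeryVaughan2007, §11.1] -/
theorem norm_iteratedDeriv_two_LFunction_one_le (hq : 3 ≤ Real.log q) (hχ : χ.IsPrimitive) :
    ‖iteratedDeriv 2 χ.LFunction 1‖ ≤ 4 * Real.exp (9 / 2) * (1 + Real.log q) * Real.log q ^ 2 := by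
  have hL0 : 0 < Real.log q := by linarith
  have hw : ‖(1 : ℂ) - 1‖ ≤ 1 / Real.log q := by
    rw [sub_self, norm_zero]; exact (one_div_pos.2 hL0).le
  have h := norm_iteratedDeriv_LFunction_le_near_one χ 2 hq hχ hw
  calc ‖iteratedDeriv 2 χ.LFunction 1‖
      ≤ (Nat.factorial 2 : ℕ) * (2 * Real.exp (9 / 2) * (1 + Real.log q)) * Real.log q ^ 2 := h
    _ = 4 * Real.exp (9 / 2) * (1 + Real.log q) * Real.log q ^ 2 := by
        rw [Nat.factorial_two]; push_cast; ring

/-- **`‖L″(1, χ)‖ ≤ 8e^{9/2}·(log q)³`** (`1 + log q ≤ 2 log q` for `log q ≥ 3`): the `≪ log³q` form.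
[cite: MontgomeryVaughan2007, §11.1] -/
theorem norm_iteratedDeriv_two_LFunction_one_le_log_cube (hq : 3 ≤ Real.log q) (hχ : χ.IsPrimitive) :
    ‖iteratedDeriv 2 χ.LFunction 1‖ ≤ 8 * Real.exp (9 / 2) * Real.log q ^ 3 := by
  have h := norm_iteratedDeriv_two_LFunction_one_le χ hq hχ
  have hL0 : 0 < Real.log q := by linarith
  have h1 : 1 + Real.log q ≤ 2 * Real.log q := by linarith
  have he : 0 < Real.exp (9 / 2) := Real.exp_pos _
  calc ‖iteratedDeriv 2 χ.LFunction 1‖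
      ≤ 4 * Real.exp (9 / 2) * (1 + Real.log q) * Real.log q ^ 2 := h
    _ ≤ 4 * Real.exp (9 / 2) * (2 * Real.log q) * Real.log q ^ 2 := by gcongr
    _ = 8 * Real.exp (9 / 2) * Real.log q ^ 3 := by ring

/-- The first derivative at `1` in the same currency: `‖L′(1,χ)‖ ≤ 2e^{9/2}(1 + log q)·log q`
(the tree's `norm_deriv_LFunction_le_near_one` at `w = 1`, restated with `iteratedDeriv 1` for
consumers that index derivatives uniformly). [cite: MontgomeryVaughan2007, §11.1] -/
theorem norm_iteratedDeriv_one_LFunction_one_le (hq : 3 ≤ Real.log q) (hχ : χ.IsPrimitive) :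
    ‖iteratedDeriv 1 χ.LFunction 1‖ ≤ 2 * Real.exp (9 / 2) * (1 + Real.log q) * Real.log q := by
  have hL0 : 0 < Real.log q := by linarith
  have hw : ‖(1 : ℂ) - 1‖ ≤ 1 / Real.log q := by
    rw [sub_self, norm_zero]; exact (one_div_pos.2 hL0).le
  have h := norm_iteratedDeriv_LFunction_le_near_one χ 1 hq hχ hw
  calc ‖iteratedDeriv 1 χ.LFunction 1‖
      ≤ (Nat.factorial 1 : ℕ) * (2 * Real.exp (9 / 2) * (1 + Real.log q)) * Real.log q ^ 1 := h
    _ = 2 * Real.exp (9 / 2) * (1 + Real.log q) * Real.log q := by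
        rw [Nat.factorial_one]; push_cast; ring

end NearOne

end Literature.NumberTheory.LFunctions.Zhang2022.Lemma31
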